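import Summits.QuantumFields.BalabanUV.Beta.FP.TorusHSideJetPeriodic

/-!
# `BalabanUV.Beta.FP.TorusHSideJetConjPeriodic` — road «FP» for binder row D1, ROUTE T (β1), SPEC-48 §E (E3b):
# **THE `X`-CONJUGATED FIRST-ORDER H-SIDE JET `H′₁f v` OF THE END WRAPPER IS ONE PERIODISED LATTICE KERNEL `perF T (dper T 𝒴)` —
# the commutator `−(XᵀH₀) + H₀X`, `X = −(c • diagonal (λ ∘ pr))`, as the periodisation of the DISPLAYED lattice kernel
# `c·(λ̃ x − λ̃ y)·K₀ x y|ff` for ANY lattice pre-image `λ̃` of the torus multiplier direction `λ`; `𝒴 = 𝒳 + 𝒱` DISPLAYED**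

WHY.  The END wrapper `StepRecursionFeedNestedNamedB.d1Tel_JcComp_ctr_named` (p405971 ✓) pins (`hH'₁f`)
`H′₁f v = −((−(c • diagonal (fun b => lv v b.1)))ᵀ * H₀) + H₁f v + H₀ * (−(c • diagonal (fun b => lv v b.1)))`, `H₀ = (perF T K₀)|ff`
(`K₀ = bhKStepSh 3 Lc (Dsh Lc) 0`, `T := towerTorus Lc M n`), and its N-binding `hHN₁` reads `H′₁f (dv (μ, y))` as ONE periodised lattice kernel
`(perF T (dper T (VN … μ y)))|ff`.  g37 (`TorusHSideJetPeriodic.H1f_eq_perF_dper`, p414074 ✓) typed `H₁f v = perF T (dper T 𝒱)`, `𝒱` displayed.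
THIS FILE closes (E3b): the two conjugation terms are the commutator `c·[diagonal λ, H₀]`, entrywise `c·(λ p − λ q)·H₀ p q`; for any
lattice function `λ̃` whose `T`-periodisation `Λ x := Σ'_m λ̃ (x + T∘m)` restricts to `λ` on the box, and any `T`-bi-invariant `K₀`, the lattice
kernel `𝒳 x y a b := c·(λ̃ x − λ̃ y)·K₀ x y (inl a) (inl b)` has `dper T 𝒳 = c·(Λ x − Λ y)·K₀|ff` (§2) and `perF T (dper T 𝒳) = −(XᵀH₀) + H₀X` (§2,
`perF_dper_conj`); with §1 of g37 (`perF ∘ dper` additive under the letters) **`H′₁f v = perF T (dper T 𝒴)`** for the DISPLAYED `𝒴 = 𝒳 + 𝒱`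
(§3 `H'1f_eq_perF_dper`), the two letters of `𝒴` exported; §4 the CANONICAL pre-image (the box lift `λ̃ := [x ∈ pbox T]·λ x`) meets the
two letters of `λ̃`, so the statement holds for EVERY torus direction with no further data (`H'1f_eq_perF_dper_boxLift`).

WHAT ([folklore] `tsum` ∕ matrix bookkeeping BY NAME; no `def`, no `def … : Prop`, nothing cited, 0 sorry):
§1 `perScalar_translate`, `tsum_sub_translate` (a periodised scalar is `T`-periodic; the period sum of a difference); §2 `dper_conj_apply`,
`summable_conj_diag`, `summable_conj_right`, `conj_entry`, **`perF_dper_conj`**; §3 **`H'1f_eq_perF_dper`**, `summable_H'1fKernel_diag ∕ _right`;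
§4 `translate_mem_pbox_iff`, `summable_boxLift_translate`, `tsum_boxLift_translate`, **`H'1f_eq_perF_dper_boxLift`**.
WRAPPER DICTIONARY (instantiate, nothing to prove but the two letters of `K₀`): `d := 3`, `n := n+1`, `M := fine Lc (Mc B)`, `T := towerTorus Lc M (n+1)`,
`K₀ := bhKStepSh 3 Lc (Dsh Lc) 0` (`hK₀` from `RelInvPeriodisedComb.shiftK_bhKStepSh` + `KernelPeriodisationFib.translate_invariant_of_shiftK`, `Lc ∣ T i`;
`hK₀s` from `RelInvPeriodisedComb.spr_bhKStepSh_Dsh` + `KernelPeriodisationFib.summable_translate_of_decays`), `c := c n`, `l := lv n B v`, the rest as in g37.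
WHAT THIS IS NOT: not the identification of `𝒴` with the ff-block of an2's `VN (n+1) μ y` at `v := dv n B (μ, y)` ((E4) ∕ (C1), the row's words: which
pre-image `λ̃` of `lv (dv (μ, y))` the composite stencil produces is the ROW's display — this file takes ANY); no row of the END wrapper discharged; no
estimate; nothing of Bałaban's asserted, valued or discharged; 0∕4 row-D1 binders (hW, hR, D1Tel, D1Rep); ROOT M‴ p325680 untouched; NOT (C1), NOT (L2′),
NOT (T-ID), NOT SDF, NOT D1, NOT BetaPertH, NOT continuum, NOT Clay.

HONEST DEPENDENCY (page 1, mandatory): continuum YM on T⁴ ⇐ BetaPertH ∧ nine spine estimates (0/9 proved); BetaPertH ⇐ (D1) ∧ (D4) ∧ CAP+tail;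
G-an2-4 gates asym, D1 and NE2/3/4.  HONEST FRAMING (cell contract, verbatim): «discharging `BetaPertH` makes Bałaban's UV stability UNCONDITIONAL —
a real constructive-QFT result; it is NOT the continuum limit and NOT the Clay problem.»  ABSOLUTE RULE (cell charter, verbatim): «No internally-minted
statement may enter as a cited fact. Every hypothesis is either kernel-proved in this package or a verbatim quotation of a PUBLISHED theorem with page
reference. The manuscript(s) under audit are NOT citable for their own disputed steps — they are the thing under adjudication; programme-internal
(2001/route/tribunal) claims are never citable.»  Road «FP» OWNER, b2b-balaban-beta-d1-p3 gen 38, 2026-08-26.  No existing file touched.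
-/

noncomputable section

open scoped BigOperators

namespace Summit.QuantumFields.BalabanUV.Beta.FP.TorusHSideJetConjPeriodic

open Finset Matrix
open Literature.MathematicalPhysics.QuantumFieldTheory.Balaban1983to89 Literature.MathematicalPhysics.QuantumFieldTheory.Balaban1983to89.Beta
open B4TorusKernel.MultiPeriod (translate translate_apply translate_injective)  open B4Reflection242 (translate_translate)  open B6Lemma24Torus (pbox mem_pbox)
open AffineAveraging (Site)  open AveragingHessianKernels (Bond)
open AveragingContoursRooted (ctr)  open ExpKernelCalculus (MKer)  open OneStepResolventKernel (Fib LocStencil)  open InterLevelTransport (SLam)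
open StepJetData (wilsonA)
open Summit.QuantumFields.BalabanUV.Beta.SymAveragingHessianCounts (symLinKerAt)  open Summit.QuantumFields.BalabanUV.Beta.BorderedHessian (stepScale)
open Summit.QuantumFields.BalabanUV.Beta.CompositeVertexKernelRec (compLinKer)
open Summit.QuantumFields.BalabanUV.Beta.GAN24.KernelPeriodisation (quo quo_translate)
open Summit.QuantumFields.BalabanUV.Beta.GAN24.DirichletExhaustionDeperiodise (translate_zero)
open Summit.QuantumFields.BalabanUV.Beta.FP.KernelPeriodisationFib (Idx perF perF_apply perZ perZ_apply)
open Summit.QuantumFields.BalabanUV.Beta.FP.KernelPeriodisationFibLoc (dper dper_apply)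
open Summit.QuantumFields.BalabanUV.Beta.FP.TorusCompositeObjects (towerTorus)
open Summit.QuantumFields.BalabanUV.Beta.FP.TorusCompositeCompanionSumG (compSumSym)  open Summit.QuantumFields.BalabanUV.Beta.FP.TorusCompositeCompanionFamilyG (onTowerFamily)
open Summit.QuantumFields.BalabanUV.Beta.FP.TorusHSideJetPeriodic (perF_dper_of_eq_add summable_diag_of_eq_add summable_right_of_eq_add H1f_eq_perF_dper
  summable_H1fKernel_diag summable_H1fKernel_right)

variable {d : ℕ}

/-! ## §1 A periodised scalar: the `T`-periodisation `Λ` of a lattice function `λ̃` -/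

section Scalar

variable (T : Fin (d + 1) → ℕ) (s : (Fin (d + 1) → ℤ) → ℝ) {S : (Fin (d + 1) → ℤ) → ℝ}
  (hS : ∀ x : Fin (d + 1) → ℤ, S x = ∑' m : Fin (d + 1) → ℤ, s (translate T x m))
include hS

/-- [folklore] **a periodised scalar is `T`-periodic**: `Λ (x + T∘m₀) = Λ x` for `Λ x := Σ'_m λ̃ (x + T∘m)` (re-indexing `m ↦ m₀ + m`; no convergence needed). -/
theorem perScalar_translate (x m₀ : Fin (d + 1) → ℤ) : S (translate T x m₀) = S x := by
  rw [hS, hS]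
  simp only [translate_translate]
  exact (Equiv.addLeft m₀).tsum_eq fun m => s (translate T x m)

/-- [folklore] the period sum of a difference of translates is the difference of the periodisations, under the summability letter of `λ̃`. -/
theorem tsum_sub_translate (hs : ∀ x : Fin (d + 1) → ℤ, Summable fun m : Fin (d + 1) → ℤ => s (translate T x m)) (x y : Fin (d + 1) → ℤ) :
    ∑' m : Fin (d + 1) → ℤ, (s (translate T x m) - s (translate T y m)) = S x - S y := by
  rw [hS, hS]
  exact (hs x).tsum_sub (hs y)

end Scalar

/-! ## §2 The conjugation kernel `𝒳 = c·(λ̃ x − λ̃ y)·K₀|ff`: its diagonal periodisation, its letters, its periodised matrix -/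

section Conj

variable (T : Fin (d + 1) → ℕ) (K₀ : MKer (d + 1) (Fib d))
  (hK₀ : ∀ (m x y : Fin (d + 1) → ℤ) (a b : Fin (d + 1)), K₀ (translate T x m) (translate T y m) (Sum.inl a) (Sum.inl b) = K₀ x y (Sum.inl a) (Sum.inl b))
  (s : (Fin (d + 1) → ℤ) → ℝ) (hs : ∀ x : Fin (d + 1) → ℤ, Summable fun m : Fin (d + 1) → ℤ => s (translate T x m))
  {S : (Fin (d + 1) → ℤ) → ℝ} (hS : ∀ x : Fin (d + 1) → ℤ, S x = ∑' m : Fin (d + 1) → ℤ, s (translate T x m))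
  (c : ℝ) {𝒳 : MKer (d + 1) (Fin (d + 1))}
  (h𝒳 : ∀ (x y : Fin (d + 1) → ℤ) (a b : Fin (d + 1)), 𝒳 x y a b = c * (s x - s y) * K₀ x y (Sum.inl a) (Sum.inl b))
include hK₀ hs hS h𝒳

/-- [folklore] **`dper_conj_apply` — THE DIAGONAL PERIODISATION OF THE CONJUGATION KERNEL**: `dper T 𝒳 x y a b = c·(Λ x − Λ y)·K₀ x y (inl a) (inl b)`
(`K₀` bi-invariant comes out of the period sum; the summability letter of `λ̃` splits the difference). -/
theorem dper_conj_apply (x y : Fin (d + 1) → ℤ) (a b : Fin (d + 1)) :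
    dper T 𝒳 x y a b = c * (S x - S y) * K₀ x y (Sum.inl a) (Sum.inl b) := by
  simp only [dper_apply, h𝒳, hK₀]
  rw [show (fun m : Fin (d + 1) → ℤ => c * (s (translate T x m) - s (translate T y m)) * K₀ x y (Sum.inl a) (Sum.inl b))
      = fun m : Fin (d + 1) → ℤ => (c * K₀ x y (Sum.inl a) (Sum.inl b)) * (s (translate T x m) - s (translate T y m)) from
      funext fun m => by ring, tsum_mul_left, tsum_sub_translate T s hS hs]
  ring

omit hS in
/-- [folklore] **the diagonal letter of `𝒳`** on the torus `T` (from the letter of `λ̃`). -/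
theorem summable_conj_diag (x y : Fin (d + 1) → ℤ) (a b : Fin (d + 1)) :
    Summable fun m₀ : Fin (d + 1) → ℤ => 𝒳 (translate T x m₀) (translate T y m₀) a b := by
  simp only [h𝒳, hK₀]
  exact (((hs x).sub (hs y)).mul_left c).mul_right (K₀ x y (Sum.inl a) (Sum.inl b))

variable (hK₀s : ∀ (x y : Fin (d + 1) → ℤ) (a b : Fin (d + 1)), Summable fun m : Fin (d + 1) → ℤ => K₀ x (translate T y m) (Sum.inl a) (Sum.inl b))
include hK₀s

/-- [folklore] **the second-argument letter of `𝒳`** on the torus `T` (from the `perZ` letter of `K₀|ff`). -/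
theorem summable_conj_right (x y : Fin (d + 1) → ℤ) (a b : Fin (d + 1)) :
    Summable fun m : Fin (d + 1) → ℤ => dper T 𝒳 x (translate T y m) a b := by
  simp only [dper_conj_apply T K₀ hK₀ s hs hS c h𝒳, perScalar_translate T s hS]
  exact (hK₀s x y a b).mul_left (c * (S x - S y))

variable (l : ↥(pbox T) → ℝ) (hl : ∀ r : ↥(pbox T), l r = S (r : Fin (d + 1) → ℤ))
include hl

omit hK₀s in
/-- [folklore] the periodised conjugation kernel, entrywise: `perF T (dper T 𝒳) p q = c·(λ p.1 − λ q.1)·(perF T K₀) (p.1, inl p.2) (q.1, inl q.2)`. -/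
theorem conj_entry (p q : Idx T (Fin (d + 1))) :
    perF T (dper T 𝒳) p q = c * (l p.1 - l q.1) * perF T K₀ ((p.1, Sum.inl p.2) : Idx T (Fib d)) ((q.1, Sum.inl q.2) : Idx T (Fib d)) := by
  simp only [perF_apply, perZ_apply, dper_conj_apply T K₀ hK₀ s hs hS c h𝒳, perScalar_translate T s hS, hl]
  exact tsum_mul_left

omit hK₀s in
/-- [folklore] **`perF_dper_conj` — THE TWO CONJUGATION TERMS OF `hH'₁f` ARE ONE PERIODISED LATTICE KERNEL**:
`−((−(c • diagonal (λ ∘ pr)))ᵀ * (perF T K₀)|ff) + (perF T K₀)|ff * (−(c • diagonal (λ ∘ pr))) = perF T (dper T 𝒳)` — the commutator `c·[diagonal λ, H₀]`. -/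
theorem perF_dper_conj :
    -((-(c • Matrix.diagonal (fun b : ↥(pbox T) × Fin (d + 1) => l b.1)))ᵀ
          * (perF T K₀).submatrix (fun b : ↥(pbox T) × Fin (d + 1) => ((b.1, Sum.inl b.2) : Idx T (Fib d)))
              (fun b : ↥(pbox T) × Fin (d + 1) => ((b.1, Sum.inl b.2) : Idx T (Fib d))))
      + (perF T K₀).submatrix (fun b : ↥(pbox T) × Fin (d + 1) => ((b.1, Sum.inl b.2) : Idx T (Fib d)))
            (fun b : ↥(pbox T) × Fin (d + 1) => ((b.1, Sum.inl b.2) : Idx T (Fib d)))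
          * (-(c • Matrix.diagonal (fun b : ↥(pbox T) × Fin (d + 1) => l b.1)))
      = perF T (dper T 𝒳) := by
  rw [Matrix.transpose_neg, Matrix.transpose_smul, Matrix.diagonal_transpose, Matrix.neg_mul, neg_neg, Matrix.mul_neg, Matrix.smul_mul,
    Matrix.mul_smul]
  ext p q
  have h := conj_entry T K₀ hK₀ s hs hS c h𝒳 l hl p q
  simp only [Matrix.add_apply, Matrix.neg_apply, Matrix.smul_apply, smul_eq_mul, Matrix.diagonal_mul, Matrix.mul_diagonal, Matrix.submatrix_apply] at h ⊢
  rw [h]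
  ring

end Conj

/-! ## §3 `H′₁f v` is one periodised lattice kernel -/

/-- [folklore] the display of `𝒴` as the sum of the two lattice kernels `𝒳` (conjugation) and `𝒱` (g37's jet kernel). -/
theorem H'1fKernel_eq {K₀ : MKer (d + 1) (Fib d)} {s : (Fin (d + 1) → ℤ) → ℝ} {c : ℝ} {𝒳 𝒱 𝒴 : MKer (d + 1) (Fin (d + 1))}
    (h𝒳 : ∀ (x y : Fin (d + 1) → ℤ) (a b : Fin (d + 1)), 𝒳 x y a b = c * (s x - s y) * K₀ x y (Sum.inl a) (Sum.inl b))
    (h𝒴 : ∀ (x y : Fin (d + 1) → ℤ) (a b : Fin (d + 1)), 𝒴 x y a b = c * (s x - s y) * K₀ x y (Sum.inl a) (Sum.inl b) + 𝒱 x y a b) :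
    𝒴 = 𝒳 + 𝒱 := by
  funext x y a b
  rw [h𝒴 x y a b]
  simp only [Pi.add_apply]
  rw [h𝒳 x y a b]

section Storeys

variable (Lc : ℕ) [NeZero Lc] (N n : ℕ) (M : Fin (d + 1) → ℕ) [∀ μ, NeZero (M μ)] (lev : ℕ → ℕ)
  (ℓ : ℕ → Fin (d + 1) → Site (d + 1) → Bond (d + 1) → ℝ)
  (𝒽 : Fin (d + 1) → Site (d + 1) → MKer (d + 1) (Fib d))
  (cf : ℕ → Fin (d + 1) → Site (d + 1) → Fin (d + 1) → Site (d + 1) → ℝ) (w : ℕ → ℝ)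
  (hb : (k : ℕ) → (↥(pbox (towerTorus Lc M k)) × Fin (d + 1) → ℝ))
  {Cs : ℕ → ℝ} {δ : ℝ} (hLS : ∀ j, LocStencil (SLam N (cf j) 𝒽) (Cs j) δ) (hCs : ∀ j, 0 ≤ Cs j) (hδ : 0 < δ)
  (hℓ : ∀ i < n, ∀ (μ : Fin (d + 1)) (y : Site (d + 1)) (g : Bond (d + 1)),
    ℓ i μ y g = stepScale d Lc (lev (n - i)) * ((Lc : ℝ) ^ (d + 1) * symLinKerAt (ctr (d + 1) Lc) Lc μ y g))
  {𝒦 : ℕ → MKer (d + 1) (Fin (d + 1))}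
  (h𝒦 : ∀ j ≤ n, ∀ (β β' : Site (d + 1)) (b b' : Fin (d + 1)), 𝒦 j β β' b b'
    = ∑ a : Fin (d + 1), ∑ a' : Fin (d + 1), ∑' γ : Site (d + 1), ∑' γ' : Site (d + 1),
        compLinKer ℓ Lc (n - j) (b, β) (a, γ)
          * (w j * ∑ ā : ↥(pbox (towerTorus Lc M j)) × Fin (d + 1),
              hb j ā * SLam N (cf j) 𝒽 ā.2 (ā.1 : Site (d + 1)) γ γ' (Sum.inl a) (Sum.inl a'))
          * compLinKer ℓ Lc (n - j) (b', β') (a', γ'))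
  {𝒱 : MKer (d + 1) (Fin (d + 1))} (c : ℝ)
  (h𝒱 : ∀ (x y : Site (d + 1)) (a b : Fin (d + 1)), 𝒱 x y a b
    = (-2 * c) * (∑ b₀ : ↥(pbox (towerTorus Lc M n)) × Fin (d + 1), hb n b₀ * wilsonA d b₀.2 (b₀.1 : Site (d + 1)) x y (Sum.inl a) (Sum.inl b))
      + ∑ j ∈ Finset.range (n + 1), 𝒦 j x y a b)
  -- the conjugation data: the torus Hessian kernel `K₀` (bi-invariant under `towerTorus Lc M n`, with its `perZ` letter at `ff`), a lattice pre-image `λ̃ =: s`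
  -- of the torus multiplier direction `λ =: l` (its periodisation `Λ =: S` restricts to `l` on the box), the displayed kernels `𝒳` and `𝒴 = 𝒳 + 𝒱`
  (K₀ : MKer (d + 1) (Fib d))
  (hK₀ : ∀ (m x y : Fin (d + 1) → ℤ) (a b : Fin (d + 1)),
    K₀ (translate (towerTorus Lc M n) x m) (translate (towerTorus Lc M n) y m) (Sum.inl a) (Sum.inl b) = K₀ x y (Sum.inl a) (Sum.inl b))
  (hK₀s : ∀ (x y : Fin (d + 1) → ℤ) (a b : Fin (d + 1)), Summable fun m : Fin (d + 1) → ℤ => K₀ x (translate (towerTorus Lc M n) y m) (Sum.inl a) (Sum.inl b))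
  (s : Site (d + 1) → ℝ) (hs : ∀ x : Site (d + 1), Summable fun m : Fin (d + 1) → ℤ => s (translate (towerTorus Lc M n) x m))
  {S : Site (d + 1) → ℝ} (hS : ∀ x : Site (d + 1), S x = ∑' m : Fin (d + 1) → ℤ, s (translate (towerTorus Lc M n) x m))
  (l : ↥(pbox (towerTorus Lc M n)) → ℝ) (hl : ∀ r : ↥(pbox (towerTorus Lc M n)), l r = S (r : Site (d + 1)))
  {𝒳 : MKer (d + 1) (Fin (d + 1))}
  (h𝒳 : ∀ (x y : Site (d + 1)) (a b : Fin (d + 1)), 𝒳 x y a b = c * (s x - s y) * K₀ x y (Sum.inl a) (Sum.inl b))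
  {𝒴 : MKer (d + 1) (Fin (d + 1))}
  (h𝒴 : ∀ (x y : Site (d + 1)) (a b : Fin (d + 1)), 𝒴 x y a b = c * (s x - s y) * K₀ x y (Sum.inl a) (Sum.inl b) + 𝒱 x y a b)

include hLS hCs hδ hℓ h𝒦 h𝒱 hK₀ hs h𝒳 h𝒴

/-- [folklore] **THE DIAGONAL LETTER OF `𝒴`** on the finest torus. -/
theorem summable_H'1fKernel_diag (x y : Site (d + 1)) (a b : Fin (d + 1)) :
    Summable fun m₀ : Site (d + 1) => 𝒴 (translate (towerTorus Lc M n) x m₀) (translate (towerTorus Lc M n) y m₀) a b :=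
  summable_diag_of_eq_add (towerTorus Lc M n) (H'1fKernel_eq h𝒳 h𝒴) (summable_conj_diag (towerTorus Lc M n) K₀ hK₀ s hs c h𝒳)
    (summable_H1fKernel_diag Lc N n M lev ℓ 𝒽 cf w hb hLS hCs hδ hℓ h𝒦 c h𝒱) x y a b

include hS hK₀s

/-- [folklore] **THE SECOND-ARGUMENT LETTER OF `𝒴`** on the finest torus. -/
theorem summable_H'1fKernel_right (x y : Site (d + 1)) (a b : Fin (d + 1)) :
    Summable fun m : Site (d + 1) => dper (towerTorus Lc M n) 𝒴 x (translate (towerTorus Lc M n) y m) a b :=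
  summable_right_of_eq_add (towerTorus Lc M n) (H'1fKernel_eq h𝒳 h𝒴) (summable_conj_diag (towerTorus Lc M n) K₀ hK₀ s hs c h𝒳)
    (summable_H1fKernel_diag Lc N n M lev ℓ 𝒽 cf w hb hLS hCs hδ hℓ h𝒦 c h𝒱) (summable_conj_right (towerTorus Lc M n) K₀ hK₀ s hs hS c h𝒳 hK₀s)
    (summable_H1fKernel_right Lc N n M lev ℓ 𝒽 cf w hb hLS hCs hδ hℓ h𝒦 c h𝒱) x y a b

include hl

/-- [folklore] **`H'1f_eq_perF_dper` — THE END WRAPPER's `X`-CONJUGATED FIRST-ORDER H-SIDE JET IS ONE PERIODISED LATTICE KERNEL** (SPEC-48 §E (E3b)).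
Data: g37's (`2 ≤ Lc`; ONE brick list `ℓ` below the depth; `𝒽 cf w hb c`; the Λ-bricks' `LocStencil` letters; the storey kernels `𝒦 j`, `j ≤ n`, and `𝒱`
DISPLAYED) PLUS the conjugation data: the torus Hessian kernel `K₀` bi-invariant under `T := towerTorus Lc M n` at `ff` (`hK₀`) with its `perZ` letter
(`hK₀s`); a lattice pre-image `λ̃` (`s`, its letter `hs`) of the torus multiplier direction `λ` (`l`): the periodisation `Λ` (`S`, `hS`) restricts to `λ` on the
box (`hl`); `𝒳` (`h𝒳`) and `𝒴 = 𝒳 + 𝒱` (`h𝒴`) DISPLAYED.  Conclusion: the `hH'₁f`-shaped matrix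
`−((−(c • diagonal (λ ∘ pr)))ᵀ * (perF T K₀)|ff) + [the hH₁f-shaped jet] + (perF T K₀)|ff * (−(c • diagonal (λ ∘ pr)))` EQUALS `perF T (dper T 𝒴)`. -/
theorem H'1f_eq_perF_dper (hLc : 2 ≤ Lc) (rs : ℕ → (Fin (d + 1) → ℕ)) :
    -((-(c • Matrix.diagonal (fun b : ↥(pbox (towerTorus Lc M n)) × Fin (d + 1) => l b.1)))ᵀ
          * (perF (towerTorus Lc M n) K₀).submatrix
              (fun b : ↥(pbox (towerTorus Lc M n)) × Fin (d + 1) => ((b.1, Sum.inl b.2) : Idx (towerTorus Lc M n) (Fib d)))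
              (fun b : ↥(pbox (towerTorus Lc M n)) × Fin (d + 1) => ((b.1, Sum.inl b.2) : Idx (towerTorus Lc M n) (Fib d))))
      + ((-2 * c) • ∑ b₀ : ↥(pbox (towerTorus Lc M n)) × Fin (d + 1), hb n b₀ •
          (perF (towerTorus Lc M n) (dper (towerTorus Lc M n) (wilsonA d b₀.2 (b₀.1 : Site (d + 1))))).submatrix
            (fun p : ↥(pbox (towerTorus Lc M n)) × Fin (d + 1) => ((p.1, Sum.inl p.2) : Idx (towerTorus Lc M n) (Fib d)))
            (fun p : ↥(pbox (towerTorus Lc M n)) × Fin (d + 1) => ((p.1, Sum.inl p.2) : Idx (towerTorus Lc M n) (Fib d)))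
        + w n • ∑ ā : ↥(pbox (towerTorus Lc M n)) × Fin (d + 1), hb n ā •
          (perF (towerTorus Lc M n) (dper (towerTorus Lc M n) (SLam N (cf n) 𝒽 ā.2 (ā.1 : Site (d + 1))))).submatrix
            (fun p : ↥(pbox (towerTorus Lc M n)) × Fin (d + 1) => ((p.1, Sum.inl p.2) : Idx (towerTorus Lc M n) (Fib d)))
            (fun p : ↥(pbox (towerTorus Lc M n)) × Fin (d + 1) => ((p.1, Sum.inl p.2) : Idx (towerTorus Lc M n) (Fib d)))
        + compSumSym Lc (onTowerFamily Lc M (fun k => w k • ∑ ā : ↥(pbox (towerTorus Lc M k)) × Fin (d + 1), hb k ā •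
          (perF (towerTorus Lc M k) (dper (towerTorus Lc M k) (SLam N (cf k) 𝒽 ā.2 (ā.1 : Site (d + 1))))).submatrix
            (fun p : ↥(pbox (towerTorus Lc M k)) × Fin (d + 1) => ((p.1, Sum.inl p.2) : Idx (towerTorus Lc M k) (Fib d)))
            (fun p : ↥(pbox (towerTorus Lc M k)) × Fin (d + 1) => ((p.1, Sum.inl p.2) : Idx (towerTorus Lc M k) (Fib d))))) M lev rs n)
      + (perF (towerTorus Lc M n) K₀).submatrix
            (fun b : ↥(pbox (towerTorus Lc M n)) × Fin (d + 1) => ((b.1, Sum.inl b.2) : Idx (towerTorus Lc M n) (Fib d)))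
            (fun b : ↥(pbox (towerTorus Lc M n)) × Fin (d + 1) => ((b.1, Sum.inl b.2) : Idx (towerTorus Lc M n) (Fib d)))
          * (-(c • Matrix.diagonal (fun b : ↥(pbox (towerTorus Lc M n)) × Fin (d + 1) => l b.1)))
      = perF (towerTorus Lc M n) (dper (towerTorus Lc M n) 𝒴) := by
  rw [H1f_eq_perF_dper Lc N n M lev ℓ 𝒽 cf w hb hLS hCs hδ hℓ h𝒦 c h𝒱 hLc rs, add_right_comm,
    perF_dper_conj (towerTorus Lc M n) K₀ hK₀ s hs hS c h𝒳 l hl,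
    perF_dper_of_eq_add (towerTorus Lc M n) (H'1fKernel_eq h𝒳 h𝒴) (summable_conj_diag (towerTorus Lc M n) K₀ hK₀ s hs c h𝒳)
      (summable_H1fKernel_diag Lc N n M lev ℓ 𝒽 cf w hb hLS hCs hδ hℓ h𝒦 c h𝒱) (summable_conj_right (towerTorus Lc M n) K₀ hK₀ s hs hS c h𝒳 hK₀s)
      (summable_H1fKernel_right Lc N n M lev ℓ 𝒽 cf w hb hLS hCs hδ hℓ h𝒦 c h𝒱)]

end Storeys

/-! ## §4 The canonical pre-image: the box lift `λ̃ := [x ∈ pbox T]·λ x` of a torus direction meets the two letters -/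

section BoxLift

variable (T : Fin (d + 1) → ℕ) [∀ μ, NeZero (T μ)]

/-- [folklore] **box uniqueness**: a translate `r + T∘m` of a box point `r ∈ pbox T` lies in the box iff `m = 0` (`quo_translate`). -/
theorem translate_mem_pbox_iff {r : Fin (d + 1) → ℤ} (hr : r ∈ pbox T) (m : Fin (d + 1) → ℤ) : translate T r m ∈ pbox T ↔ m = 0 := by
  refine ⟨fun h => ?_, fun h => by rwa [h, translate_zero]⟩
  have h1 := quo_translate T h 0
  rw [translate_zero, quo_translate T hr m] at h1
  exact h1

variable (l : ↥(pbox T) → ℝ) (s : (Fin (d + 1) → ℤ) → ℝ) (hsl : ∀ x : Fin (d + 1) → ℤ, s x = if h : x ∈ pbox T then l ⟨x, h⟩ else 0)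
include hsl

omit [∀ μ, NeZero (T μ)] in
/-- [folklore] the box lift vanishes off the box. -/
theorem boxLift_of_not_mem {x : Fin (d + 1) → ℤ} (hx : x ∉ pbox T) : s x = 0 := by
  rw [hsl, dif_neg hx]

omit [∀ μ, NeZero (T μ)] in
/-- [folklore] the box lift on the box. -/
theorem boxLift_of_mem (r : ↥(pbox T)) : s (r : Fin (d + 1) → ℤ) = l r := by
  rw [hsl, dif_pos r.2]

/-- [folklore] along the translates of ANY site the box lift is supported on one multi-index (`x = wrap x + T∘quo x`), hence summable. -/
theorem summable_boxLift_translate (x : Fin (d + 1) → ℤ) : Summable fun m : Fin (d + 1) → ℤ => s (translate T x m) := by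
  refine summable_of_ne_finset_zero (s := {-quo T x}) fun m hm => ?_
  refine boxLift_of_not_mem T l s hsl fun hmem => hm (Finset.mem_singleton.mpr ?_)
  -- `x + T∘m ∈ pbox` ⟹ `x + T∘m` is its own remainder, and `x = (x + T∘m) + T∘(−m)` ⟹ `−m = quo` of … no: compute `quo (x + T∘m) = 0`, `quo` additive
  have h0 : quo T (translate T (translate T x m) 0) = 0 := quo_translate T hmem 0
  rw [translate_zero] at h0
  have hq : quo T (translate T x m) = quo T x + m := by
    funext i
    have hM : (T i : ℤ) ≠ 0 := by exact_mod_cast NeZero.ne (T i)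
    simp only [quo, translate_apply, Pi.add_apply]
    rw [Int.add_mul_ediv_left _ _ hM]
  rw [hq] at h0
  exact (neg_eq_of_add_eq_zero_right h0).symm

/-- [folklore] **the periodisation of the box lift restricts to the torus direction on the box**: `Σ'_m λ̃ (r + T∘m) = λ r` for `r ∈ pbox T`
(only `m = 0` lands in the box, `translate_mem_pbox_iff`). -/
theorem tsum_boxLift_translate (r : ↥(pbox T)) : l r = ∑' m : Fin (d + 1) → ℤ, s (translate T (r : Fin (d + 1) → ℤ) m) := by
  rw [tsum_eq_single 0 fun m hm => boxLift_of_not_mem T l s hsl fun h => hm ((translate_mem_pbox_iff T r.2 m).mp h), translate_zero,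
    boxLift_of_mem T l s hsl r]

end BoxLift

section StoreysBoxLift

variable (Lc : ℕ) [NeZero Lc] (N n : ℕ) (M : Fin (d + 1) → ℕ) [∀ μ, NeZero (M μ)] (lev : ℕ → ℕ)
  (ℓ : ℕ → Fin (d + 1) → Site (d + 1) → Bond (d + 1) → ℝ)
  (𝒽 : Fin (d + 1) → Site (d + 1) → MKer (d + 1) (Fib d))
  (cf : ℕ → Fin (d + 1) → Site (d + 1) → Fin (d + 1) → Site (d + 1) → ℝ) (w : ℕ → ℝ)
  (hb : (k : ℕ) → (↥(pbox (towerTorus Lc M k)) × Fin (d + 1) → ℝ))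
  {Cs : ℕ → ℝ} {δ : ℝ} (hLS : ∀ j, LocStencil (SLam N (cf j) 𝒽) (Cs j) δ) (hCs : ∀ j, 0 ≤ Cs j) (hδ : 0 < δ)
  (hℓ : ∀ i < n, ∀ (μ : Fin (d + 1)) (y : Site (d + 1)) (g : Bond (d + 1)),
    ℓ i μ y g = stepScale d Lc (lev (n - i)) * ((Lc : ℝ) ^ (d + 1) * symLinKerAt (ctr (d + 1) Lc) Lc μ y g))
  {𝒦 : ℕ → MKer (d + 1) (Fin (d + 1))}
  (h𝒦 : ∀ j ≤ n, ∀ (β β' : Site (d + 1)) (b b' : Fin (d + 1)), 𝒦 j β β' b b'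
    = ∑ a : Fin (d + 1), ∑ a' : Fin (d + 1), ∑' γ : Site (d + 1), ∑' γ' : Site (d + 1),
        compLinKer ℓ Lc (n - j) (b, β) (a, γ)
          * (w j * ∑ ā : ↥(pbox (towerTorus Lc M j)) × Fin (d + 1),
              hb j ā * SLam N (cf j) 𝒽 ā.2 (ā.1 : Site (d + 1)) γ γ' (Sum.inl a) (Sum.inl a'))
          * compLinKer ℓ Lc (n - j) (b', β') (a', γ'))
  {𝒱 : MKer (d + 1) (Fin (d + 1))} (c : ℝ)
  (h𝒱 : ∀ (x y : Site (d + 1)) (a b : Fin (d + 1)), 𝒱 x y a b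
    = (-2 * c) * (∑ b₀ : ↥(pbox (towerTorus Lc M n)) × Fin (d + 1), hb n b₀ * wilsonA d b₀.2 (b₀.1 : Site (d + 1)) x y (Sum.inl a) (Sum.inl b))
      + ∑ j ∈ Finset.range (n + 1), 𝒦 j x y a b)
  (K₀ : MKer (d + 1) (Fib d))
  (hK₀ : ∀ (m x y : Fin (d + 1) → ℤ) (a b : Fin (d + 1)),
    K₀ (translate (towerTorus Lc M n) x m) (translate (towerTorus Lc M n) y m) (Sum.inl a) (Sum.inl b) = K₀ x y (Sum.inl a) (Sum.inl b))
  (hK₀s : ∀ (x y : Fin (d + 1) → ℤ) (a b : Fin (d + 1)), Summable fun m : Fin (d + 1) → ℤ => K₀ x (translate (towerTorus Lc M n) y m) (Sum.inl a) (Sum.inl b))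
  -- the torus multiplier direction and its CANONICAL pre-image (the box lift), the displayed kernel `𝒴`
  (l : ↥(pbox (towerTorus Lc M n)) → ℝ) (s : Site (d + 1) → ℝ)
  (hsl : ∀ x : Site (d + 1), s x = if h : x ∈ pbox (towerTorus Lc M n) then l ⟨x, h⟩ else 0)
  {𝒴 : MKer (d + 1) (Fin (d + 1))}
  (h𝒴 : ∀ (x y : Site (d + 1)) (a b : Fin (d + 1)), 𝒴 x y a b = c * (s x - s y) * K₀ x y (Sum.inl a) (Sum.inl b) + 𝒱 x y a b)
include hLS hCs hδ hℓ h𝒦 h𝒱 hK₀ hK₀s hsl h𝒴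

/-- [folklore] **`H'1f_eq_perF_dper_boxLift` — `H′₁f v = perF T (dper T 𝒴)` FOR EVERY TORUS DIRECTION `λ`, AT THE CANONICAL PRE-IMAGE** (the box lift
`λ̃ x := [x ∈ pbox T]·λ x`, §4): g37's data, the conjugation data `K₀ hK₀ hK₀s`, the direction `l`, and `𝒴` DISPLAYED
(`𝒴 x y a b = c·(λ̃ x − λ̃ y)·K₀ x y (inl a) (inl b) + 𝒱 x y a b`) — no periodisation hypothesis left. -/
theorem H'1f_eq_perF_dper_boxLift (hLc : 2 ≤ Lc) (rs : ℕ → (Fin (d + 1) → ℕ)) :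
    -((-(c • Matrix.diagonal (fun b : ↥(pbox (towerTorus Lc M n)) × Fin (d + 1) => l b.1)))ᵀ
          * (perF (towerTorus Lc M n) K₀).submatrix
              (fun b : ↥(pbox (towerTorus Lc M n)) × Fin (d + 1) => ((b.1, Sum.inl b.2) : Idx (towerTorus Lc M n) (Fib d)))
              (fun b : ↥(pbox (towerTorus Lc M n)) × Fin (d + 1) => ((b.1, Sum.inl b.2) : Idx (towerTorus Lc M n) (Fib d))))
      + ((-2 * c) • ∑ b₀ : ↥(pbox (towerTorus Lc M n)) × Fin (d + 1), hb n b₀ •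
          (perF (towerTorus Lc M n) (dper (towerTorus Lc M n) (wilsonA d b₀.2 (b₀.1 : Site (d + 1))))).submatrix
            (fun p : ↥(pbox (towerTorus Lc M n)) × Fin (d + 1) => ((p.1, Sum.inl p.2) : Idx (towerTorus Lc M n) (Fib d)))
            (fun p : ↥(pbox (towerTorus Lc M n)) × Fin (d + 1) => ((p.1, Sum.inl p.2) : Idx (towerTorus Lc M n) (Fib d)))
        + w n • ∑ ā : ↥(pbox (towerTorus Lc M n)) × Fin (d + 1), hb n ā •
          (perF (towerTorus Lc M n) (dper (towerTorus Lc M n) (SLam N (cf n) 𝒽 ā.2 (ā.1 : Site (d + 1))))).submatrix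
            (fun p : ↥(pbox (towerTorus Lc M n)) × Fin (d + 1) => ((p.1, Sum.inl p.2) : Idx (towerTorus Lc M n) (Fib d)))
            (fun p : ↥(pbox (towerTorus Lc M n)) × Fin (d + 1) => ((p.1, Sum.inl p.2) : Idx (towerTorus Lc M n) (Fib d)))
        + compSumSym Lc (onTowerFamily Lc M (fun k => w k • ∑ ā : ↥(pbox (towerTorus Lc M k)) × Fin (d + 1), hb k ā •
          (perF (towerTorus Lc M k) (dper (towerTorus Lc M k) (SLam N (cf k) 𝒽 ā.2 (ā.1 : Site (d + 1))))).submatrix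
            (fun p : ↥(pbox (towerTorus Lc M k)) × Fin (d + 1) => ((p.1, Sum.inl p.2) : Idx (towerTorus Lc M k) (Fib d)))
            (fun p : ↥(pbox (towerTorus Lc M k)) × Fin (d + 1) => ((p.1, Sum.inl p.2) : Idx (towerTorus Lc M k) (Fib d))))) M lev rs n)
      + (perF (towerTorus Lc M n) K₀).submatrix
            (fun b : ↥(pbox (towerTorus Lc M n)) × Fin (d + 1) => ((b.1, Sum.inl b.2) : Idx (towerTorus Lc M n) (Fib d)))
            (fun b : ↥(pbox (towerTorus Lc M n)) × Fin (d + 1) => ((b.1, Sum.inl b.2) : Idx (towerTorus Lc M n) (Fib d)))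
          * (-(c • Matrix.diagonal (fun b : ↥(pbox (towerTorus Lc M n)) × Fin (d + 1) => l b.1)))
      = perF (towerTorus Lc M n) (dper (towerTorus Lc M n) 𝒴) :=
  H'1f_eq_perF_dper Lc N n M lev ℓ 𝒽 cf w hb hLS hCs hδ hℓ h𝒦 c h𝒱 K₀ hK₀ hK₀s s (summable_boxLift_translate (towerTorus Lc M n) l s hsl)
    (S := fun x => ∑' m : Fin (d + 1) → ℤ, s (translate (towerTorus Lc M n) x m)) (fun _ => rfl) l
    (tsum_boxLift_translate (towerTorus Lc M n) l s hsl) (𝒳 := fun x y a b => c * (s x - s y) * K₀ x y (Sum.inl a) (Sum.inl b)) (fun _ _ _ _ => rfl)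
    h𝒴 hLc rs

end StoreysBoxLift

end Summit.QuantumFields.BalabanUV.Beta.FP.TorusHSideJetConjPeriodic

end
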